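import Mathlib.Algebra.MvPolynomial.Eval
import Mathlib.LinearAlgebra.TensorProduct.Tower
import Mathlib.LinearAlgebra.Dual.BaseChange
import Literature.AlgebraicGeometry.Motives.Varieties
import Literature.AlgebraicGeometry.Motives.VarietiesUnitProofs
import Literature.AlgebraicGeometry.Motives.SegreEmbedding
import Literature.AlgebraicGeometry.Motives.BaseChange
import Literature.AlgebraicGeometry.Motives.Comparison
import Literature.AlgebraicGeometry.Motives.MotivatedCycles
import Literature.AlgebraicGeometry.Motives.PeriodComparison
import HarnessLib
import HarnessLib.Audit

/-!
# The motivated period torsor and the torsor form of the Grothendieck period conjecture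

Let `k` be a field of characteristic zero (in applications `k = ℚ̄ = AlgebraicClosure ℚ`),
`P : PeriodRealization k` the de Rham–Betti comparison data (`Motives/PeriodComparison.lean`),
`σ : k →+* ℂ`, and `X₀` a smooth projective `k`-variety of dimension `n` with cartesian powers
`X₀^m` (`SchemeOver.pow`); write `c = (P.iso σ (X₀^m) i)_{m,i} : H_dR ⊗_{k,σ} ℂ ≃ H_B ⊗_ℚ ℂ` for
the comparison isomorphisms (`H_B = P.B.comap σ`, Betti cohomology of `(X₀^m)_σ`).

Bost–Charles, *Some remarks concerning the Grothendieck period conjecture* (Crelle 714 (2016) =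
arXiv:1307.1045), Def. 2.4 and Def. 2.9, attach to `X₀/ℚ̄` the **torsor of motivated periods**
`Ω^And_{X₀}`: the closed `ℚ̄`-subscheme of `Iso(H•_dR(X₀/ℚ̄), H•_B(X₀, ℚ) ⊗ ℚ̄)` of the `f` with
`f(α_dR) = α_B` for every class `α = (α_dR, α_B) ∈ H²ᵖ_dRB(X₀^m, ℚ(p))` of a **motivated cycle**
(André 1996) on a power of `X₀`, `f` acting on `H(X₀^m)` through Künneth and on `ℚ(1)` through
the direct factor `ℚ(-1) ⊂ H²(X₀)` (loc. cit. Lemma 2.8, Rem. 2.7). It is the Tannakian torsor of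
isomorphisms between the fibre functors `H_dR` and `H_B ⊗ ℚ̄` on the André motives generated by
`X₀` (loc. cit. §2.1.2; Huber–Müller-Stach, *Periods and Nori motives* III (draft 2015),
Def. 12.2.3; André 2004, §7.5, ch. 23), and `c ∈ Ω^And_{X₀}(ℂ)` (loc. cit. Cor. 2.11:
`Z_X ⊂ Ω_X ⊂ Ω^T_X ⊂ Ω^And_X ⊂ Ω^mot_X`, `Z_X` the `ℚ̄`-Zariski closure of `c`). The
**Grothendieck period conjecture** (loc. cit. Conj. 2.12; André 2004, §7.5.2, §23.1;
Huber–Müller-Stach III, Conj. 12.2.5 (2)) is `Z_X = Ω^mot_X`, "the comparison isomorphism is dense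
in the torsor of periods"; its motivated form `Z_X = Ω^And_X` is the conditional input `GPC_And`
of route `HodgeConjecture/PeriodsPolice`. This file renders both without schemes or Tannakian
categories, unwinding the torsor on the powers of `X₀` (as Deligne–Milne, LNM 900, I §1 and
II Prop. 3.1, and Bost–Charles §2.1 do):

* `PeriodRealization.MotivatedPeriodTorsor P σ n X₀ R` — the `R`-points of `Ω^And_{X₀}` (`R` a
  commutative `k`- and `ℚ`-algebra): `R`-linear isomorphisms
  `f_{m,i} : R ⊗_k Hⁱ_dR(X₀^m) ≃ R ⊗_ℚ Hⁱ_B((X₀^m)_σ)` and a unit `t ∈ Rˣ` (the value on `ℚ(1)`),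
  natural for all `k`-morphisms between powers, unital, multiplicative, with
  `f(1 ⊗ α) = tᵖ · (1 ⊗ β)` for every motivated `β ∈ A_motᵖ((X₀^m)_σ)` (`P.B.W.motivatedClasses`)
  and its de Rham partner `α`, `c(1 ⊗ α) = (2πi)ᵖ (1 ⊗ β)` — these pairs being the classes of
  motivated cycles in `H²ᵖ_dRB(X₀^m, ℚ(p))_Gr` (loc. cit. Def. 2.1, 2.9); `c` has `t = 2πi`.
* `PeriodRealization.Coord`, `MotivatedPeriodTorsor.coord f : Coord → R` — affine coordinates:
  the coefficients `φ_R (f_{m,i} (1 ⊗ v))`, `ψ_R (f_{m,i}⁻¹ (1 ⊗ w))`, generators of the affine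
  ring of `∏ GL` (Huber–Müller-Stach III, Def. 12.2.3 and proof of Prop. 12.2.8: `(ω, γ)`,
  `ω ∈ H_dR ⊕ H_dR^∨`, `γ ∈ H_B^∨ ⊕ H_B`); at `c`: the periods of the powers of `X₀` and the
  coefficients of `c⁻¹` (`periodCoord`).
* `PeriodRealization.TorsorPeriodConjecture P σ n X₀ : Prop` — `c` is `k`-Zariski dense in
  `Ω^And_{X₀}`: every polynomial over `k` in the coordinates vanishing at the periods vanishes at
  every `R`-point, for every `R`; i.e. `I(c) ⊆ I(Ω^And)`, `Z_{X₀} = Ω^And_{X₀}`.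
* API: `IsSmoothProjective.pow`; `comparisonPoint` (`c ∈ Ω^And(ℂ)`) and `coord_comparisonPoint`;
  `IsMotivatedAutFamily`, `MotivatedPeriodTorsor.act` (stability under automorphisms of the Betti
  side fixing motivated classes); `TorsorPeriodConjecture.coord_eq_zero`.

## Design notes

* Mathlib has no period torsors, motives or Tannakian formalism (searched `torsor`, `period`,
  `Tannak`, `fiberFunctor`); the tree's `NoriMotivicInterface` posits formal periods without
  `H_dR`/`H_B`. Used: Mathlib `TensorProduct`, `LinearMap/LinearEquiv.baseChange`,
  `Module.Dual.baseChange`, `MvPolynomial.aeval`; the tree's `baseChangeBilin`, `motivatedClasses`.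
* Points over all commutative `k`-algebras `R` (functor of points), so that density is literally
  `I(c) ⊆ I(Ω^And)` (universal point), with no appeal to reducedness. `R` carries
  `[Algebra k R] [Algebra ℚ R]` (for `R = AlongHom ℂ σ` both canonical, matching `P.iso`).
* Tate character: a point of the Tannakian torsor acts on `ℚ(1) ∈ ⟨h(X₀)⟩` by a unit `t` (`2πi`
  for `c`), and the equation of a motivated class of codimension `p` reads `f(α_dR) = tᵖ β` on
  untwisted Betti classes (Bost–Charles Rem. 2.7 and after Def. 2.9). We carry `t` as the datum
  `tate`; for `dim X₀ ≥ 1` it is determined by `f` (hyperplane class), and the coordinates — hence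
  the conjecture — do not mention it. The requester's "`1 ⊗ α ↦ (2πi)ᵖ ⊗ β`" is the case `f = c`.
* de Rham partners: the equations are indexed, as in loc. cit., by the pairs `(α, β)` with
  `c(α) = (2πi)ᵖ β`, `β` motivated. For the classical realization every motivated `β` has a
  partner over `ℚ̄` (motivated cycles are absolute Hodge, André 1996 Prop. 2.5.1 and Scolie 2.5;
  Deligne 1982, Prop. 2.9); over the bare hypothesis structure a `β` without partner imposes no
  equation.
* Truncation is automatic (a polynomial involves finitely many coordinates; points are families
  over all powers, loc. cit.: `n`, `k` vary); no scheme structure or representability is claimed.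
* `TorsorPeriodConjecture` is an OPEN CONJECTURE for `k = ℚ̄` (known for CM elliptic curves,
  Chudnovsky; loc. cit. §2.2.2): a `def … : Prop` (CONVENTIONS §4), meaningful for `X₀` smooth
  projective of dimension `n` and the classical `P`; for `k` not algebraic over `ℚ` it is asserted
  nowhere (for `k = ℂ` it is false).

## References

* J.-B. Bost, F. Charles, *Some remarks concerning the Grothendieck period conjecture*, J. reine
  angew. Math. 714 (2016), arXiv:1307.1045: Def. 2.1–2.4, Lemma 2.5, Rem. 2.7, Lemma 2.8,
  Def. 2.9, Cor. 2.11, Conj. 2.12, Prop. 2.13–2.14. [BostCharles2014]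
* Y. André, *Une introduction aux motifs* (2004), §7.5, ch. 23. [Andre2004]
* Y. André, *Pour une théorie inconditionnelle des motifs*, Publ. IHÉS 83 (1996), §2.1 Déf. 1,
  §2.5 (Scolie, Prop. 2.5.1), §4.6 (Définition, (ii)). [Andre1996Motifs]
* A. Huber, S. Müller-Stach, *Periods and Nori motives* III (draft 2015), Def. 12.2.3,
  Rem. 12.2.4, Conj. 12.2.5, Prop. 12.2.8. [HuberMullerStachPeriodsIII2015]
* P. Deligne, *Hodge cycles on abelian varieties*, LNM 900 (1982), §1, Prop. 2.9, Prop. 3.1.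
  [Deligne1982HodgeCycles]
-/

open CategoryTheory AlgebraicGeometry MonoidalCategory Opposite
open scoped TensorProduct

noncomputable section

namespace Literature.AlgebraicGeometry.Motives

universe u

/-! ### Cartesian powers of a `k`-scheme -/

namespace SchemeOver

variable {k : Type u} [CommRing k]

/-- The `m`-th cartesian power `X^m = X ×ₖ ⋯ ×ₖ X` of a `k`-scheme `X`, as the iterated monoidal
product in `SchemeOver k`, bracketed `X^0 = 𝟙_ = Spec k`, `X^(m+1) = X^m ⊗ X` (Hartshorne II.3;
the self-products `Xⁿ` of Bost–Charles 2014, Def. 2.9). [folklore] -/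
def pow (X : SchemeOver k) : ℕ → SchemeOver k
  | 0 => 𝟙_ (SchemeOver k)
  | m + 1 => pow X m ⊗ X

/-- `X^0 = Spec k`. [folklore] -/
@[simp]
lemma pow_zero (X : SchemeOver k) : X.pow 0 = 𝟙_ (SchemeOver k) := rfl

/-- `X^(m+1) = X^m ×ₖ X`. [folklore] -/
@[simp]
lemma pow_succ (X : SchemeOver k) (m : ℕ) : X.pow (m + 1) = X.pow m ⊗ X := rfl

end SchemeOver

/-- Powers of a smooth projective variety of dimension `n` are smooth projective of dimension
`m * n` (from the discharged facts `isSmoothProjective_unit_holds` and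
`IsSmoothProjective.tensor_holds`; Hartshorne III.10.1, II Ex. 5.11). [folklore] -/
theorem IsSmoothProjective.pow {k : Type u} [Field k] {n : ℕ} {X : SchemeOver k}
    (hX : IsSmoothProjective n X) : ∀ m : ℕ, IsSmoothProjective (m * n) (X.pow m)
  | 0 => by
    rw [Nat.zero_mul]
    exact isSmoothProjective_unit_holds k
  | m + 1 => by
    rw [Nat.succ_mul]
    exact IsSmoothProjective.tensor_holds (hX.pow m) hX

/-! ### The motivated period torsor -/

namespace PeriodRealization

variable {k : Type} [Field k] [CharZero k] (P : PeriodRealization k) (σ : k →+* ℂ) (n : ℕ)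
  (X₀ : SchemeOver k)

/-- An **`R`-point of the torsor of motivated periods** `Ω^And_{X₀}` of a smooth projective
`k`-variety `X₀` of dimension `n` along `σ : k →+* ℂ` (Bost–Charles 2014, Def. 2.4 and Def. 2.9,
unwound on the powers of `X₀`; Huber–Müller-Stach III, Def. 12.2.3; André 2004, ch. 23), `R` a
commutative `k`-algebra: `R`-linear isomorphisms `iso m i : R ⊗_k Hⁱ_dR(X₀^m) ≃ R ⊗_ℚ Hⁱ_B((X₀^m)_σ)`
and a unit `tate ∈ Rˣ` (the value on the Tate object), natural for every `k`-morphism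
`X₀^m ⟶ X₀^m'`, unital, multiplicative, and with `iso (1 ⊗ α) = tateᵖ • (1 ⊗ β)` for every
motivated class `β ∈ A_motᵖ((X₀^m)_σ)` (André 1996, Déf. 1) and its de Rham partner `α`,
`c(1 ⊗ α) = (2πi)ᵖ (1 ⊗ β)`, `c = P.iso σ (X₀^m) (2p)` — the equation `f(α_dR) = α_B` of
Bost–Charles Def. 2.4 for the class `(α, (2πi)ᵖβ) ∈ H²ᵖ_dRB(X₀^m, ℚ(p))` of a motivated cycle. The
comparison is the point with `tate = 2πi` (`comparisonPoint`). Meaningful for `X₀` smooth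
projective of dimension `n` (which enters through `motivatedClasses (m * n)`). [cite: BostCharles2014, Def. 2.4 and Def. 2.9] -/
structure MotivatedPeriodTorsor (R : Type) [CommRing R] [Algebra k R] [Algebra ℚ R] where
  /-- The isomorphisms `R ⊗_k Hⁱ_dR(X₀^m) ≃ₗ[R] R ⊗_ℚ Hⁱ_B((X₀^m)_σ)`. -/
  iso (m i : ℕ) : R ⊗[k] P.dR.obj (X₀.pow m) i ≃ₗ[R] R ⊗[ℚ] (P.B.comap σ).obj (X₀.pow m) i
  /-- The value of the point on the Tate object `ℚ(1)` (for the comparison: `2πi`). -/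
  tate : Rˣ
  /-- Naturality for every `k`-morphism `φ : X₀^m ⟶ X₀^m'` between powers:
  `iso ∘ (φ*)_R = (φ_σ*)_R ∘ iso`. -/
  iso_pullback : ∀ ⦃m m' : ℕ⦄ (φ : X₀.pow m ⟶ X₀.pow m') (i : ℕ)
    (x : R ⊗[k] P.dR.obj (X₀.pow m') i),
    iso m i ((P.dR.pullback φ i).baseChange R x) =
      ((P.B.comap σ).pullback φ i).baseChange R (iso m' i x)
  /-- Unitality: `iso (1 ⊗ 1) = 1 ⊗ 1` on every power. -/
  iso_one : ∀ m : ℕ,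
    iso m 0 ((1 : R) ⊗ₜ[k] P.dR.one (X₀.pow m)) = (1 : R) ⊗ₜ[ℚ] (P.B.comap σ).one (X₀.pow m)
  /-- Multiplicativity for the `R`-bilinearly extended cup products on every power. -/
  iso_cup : ∀ (m : ℕ) ⦃i j l : ℕ⦄ (h : i + j = l) (x : R ⊗[k] P.dR.obj (X₀.pow m) i)
    (y : R ⊗[k] P.dR.obj (X₀.pow m) j),
    iso m l (baseChangeBilin R (P.dR.cup (X := X₀.pow m) h) x y) =
      baseChangeBilin R ((P.B.comap σ).cup (X := X₀.pow m) h) (iso m i x) (iso m j y)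
  /-- Compatibility with motivated classes up to the Tate character: if `β ∈ A_motᵖ((X₀^m)_σ)`
  and `α` is its de Rham partner (`c(1 ⊗ α) = (2πi)ᵖ (1 ⊗ β)`), then
  `iso (1 ⊗ α) = tateᵖ • (1 ⊗ β)`. -/
  iso_motivated : ∀ (m p : ℕ) (α : P.dR.obj (X₀.pow m) (2 * p))
    (β : (P.B.comap σ).obj (X₀.pow m) (2 * p)),
    β ∈ P.B.W.motivatedClasses (m * n) ((baseChangeHom σ).obj (X₀.pow m)) p →
    P.iso σ (X₀.pow m) (2 * p) ((1 : AlongHom ℂ σ) ⊗ₜ[k] α) =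
      twoPiI σ ^ p • ((1 : AlongHom ℂ σ) ⊗ₜ[ℚ] β) →
    iso m (2 * p) ((1 : R) ⊗ₜ[k] α) = (tate : R) ^ p • ((1 : R) ⊗ₜ[ℚ] β)

/-- The index type of the **affine coordinates** on the torsor of motivated periods: a matrix
coefficient `(m, i, v, φ)` of `f_{m,i}` (`v ∈ Hⁱ_dR(X₀^m)`, `φ ∈ Hⁱ_B((X₀^m)_σ)^∨`) or `(m, i, w, ψ)`
of `f_{m,i}⁻¹` (`w ∈ Hⁱ_B`, `ψ ∈ Hⁱ_dR^∨`); cf. the generators `(ω, γ)`, `ω ∈ H_dR ⊕ H_dR^∨`,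
`γ ∈ H_B^∨ ⊕ H_B`, of the ring of formal periods (Huber–Müller-Stach III, Def. 12.2.3 and proof of
Prop. 12.2.8). [cite: HuberMullerStachPeriodsIII2015, Def. 12.2.3 and proof of Prop. 12.2.8] -/
inductive Coord : Type
  /-- The coefficient `φ_R (f_{m,i} (1 ⊗ v))` of `f_{m,i}`. -/
  | iso (m i : ℕ) (v : P.dR.obj (X₀.pow m) i) (φ : Module.Dual ℚ ((P.B.comap σ).obj (X₀.pow m) i))
  /-- The coefficient `ψ_R (f_{m,i}⁻¹ (1 ⊗ w))` of the inverse `f_{m,i}⁻¹`. -/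
  | isoInv (m i : ℕ) (w : (P.B.comap σ).obj (X₀.pow m) i)
      (ψ : Module.Dual k (P.dR.obj (X₀.pow m) i))

variable {P σ n X₀}

namespace MotivatedPeriodTorsor

variable {R : Type} [CommRing R] [Algebra k R] [Algebra ℚ R] (f : P.MotivatedPeriodTorsor σ n X₀ R)

/-- The **coordinates** of an `R`-point `f` of the torsor: `(m, i, v, φ) ↦ φ_R (f_{m,i} (1 ⊗ v))`
and `(m, i, w, ψ) ↦ ψ_R (f_{m,i}⁻¹ (1 ⊗ w))`, the values at `f` of the generators of the affine
ring of `∏_{m,i} GL` (Huber–Müller-Stach III, Def. 12.2.3; Bost–Charles 2014, §2.1.2). [cite: HuberMullerStachPeriodsIII2015, Def. 12.2.3] -/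
def coord : P.Coord σ X₀ → R
  | .iso m i v φ => Module.Dual.baseChange R φ (f.iso m i ((1 : R) ⊗ₜ[k] v))
  | .isoInv m i w ψ => Module.Dual.baseChange R ψ ((f.iso m i).symm ((1 : R) ⊗ₜ[ℚ] w))

/-- The coordinate `(m, i, v, φ)` of `f`, unfolded. [folklore] -/
@[simp]
lemma coord_iso (m i : ℕ) (v : P.dR.obj (X₀.pow m) i)
    (φ : Module.Dual ℚ ((P.B.comap σ).obj (X₀.pow m) i)) :
    f.coord (.iso m i v φ) = Module.Dual.baseChange R φ (f.iso m i ((1 : R) ⊗ₜ[k] v)) := rfl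

/-- The coordinate `(m, i, w, ψ)` of `f` (a coefficient of `f⁻¹`), unfolded. [folklore] -/
@[simp]
lemma coord_isoInv (m i : ℕ) (w : (P.B.comap σ).obj (X₀.pow m) i)
    (ψ : Module.Dual k (P.dR.obj (X₀.pow m) i)) :
    f.coord (.isoInv m i w ψ) =
      Module.Dual.baseChange R ψ ((f.iso m i).symm ((1 : R) ⊗ₜ[ℚ] w)) := rfl

end MotivatedPeriodTorsor

variable (P σ X₀) in
/-- The **coordinates of the comparison isomorphism**: `(m, i, v, φ) ↦ φ_ℂ (c (1 ⊗ v))`, the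
periods `∫_γ v` of `Hⁱ(X₀^m)` along `σ` (`periodCoord_iso_mem_periodSetOf`), and
`(m, i, w, ψ) ↦ ψ_ℂ (c⁻¹ (1 ⊗ w))`, the coefficients of the inverse comparison `P.isoInv`
(Bost–Charles 2014, §2.2.1–2.2.2: the relations tested by the period conjecture are those among
the `(2πi)^{-j} ∫_γ α` on the powers of `X₀`). Built from the data `P.iso`, `P.isoInv` (no
smoothness needed); for `X₀` smooth projective these are the coordinates of `comparisonPoint`
(`coord_comparisonPoint`). [cite: BostCharles2014, §2.2.1–2.2.2] -/
def periodCoord : P.Coord σ X₀ → AlongHom ℂ σ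
  | .iso m i v φ =>
      Module.Dual.baseChange (AlongHom ℂ σ) φ (P.iso σ (X₀.pow m) i ((1 : AlongHom ℂ σ) ⊗ₜ[k] v))
  | .isoInv m i w ψ =>
      Module.Dual.baseChange (AlongHom ℂ σ) ψ
        (P.isoInv σ (X₀.pow m) i ((1 : AlongHom ℂ σ) ⊗ₜ[ℚ] w))

/-- The coordinates `(m, i, v, φ)` of the comparison are periods of `Hⁱ(X₀^m)` along `σ`
(`P.periodSetOf`, Huber–Müller-Stach 2017, Def. 11.1.1). [folklore] -/
lemma periodCoord_iso_mem_periodSetOf (m i : ℕ) (v : P.dR.obj (X₀.pow m) i)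
    (φ : Module.Dual ℚ ((P.B.comap σ).obj (X₀.pow m) i)) :
    AlongHom.equiv σ (P.periodCoord σ X₀ (.iso m i v φ)) ∈ P.periodSetOf σ (X₀.pow m) i :=
  P.mem_periodSetOf_iff.mpr ⟨v, φ, rfl⟩

variable (P σ n X₀) in
/-- OPEN CONJECTURE — **the Grothendieck period conjecture for `X₀`, torsor (motivated) form**
`GPC_And(X₀)`: the comparison isomorphism `c` is `k`-Zariski dense in the torsor of motivated
periods `Ω^And_{X₀}`, i.e. `Z_{X₀} = Ω^And_{X₀}` in the chain
`Z_X ⊂ Ω_X ⊂ Ω^T_X ⊂ Ω^And_X ⊂ Ω^mot_X` of Bost–Charles 2014, Cor. 2.11 (their Conj. 2.12,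
Grothendieck's period conjecture `Z_X = Ω^mot_X`, implies it; André 2004, §7.5.2 and §23.1;
Huber–Müller-Stach III, Conj. 12.2.5 (2): "the point `ev` is a generic point"). Rendered on
coordinates: every polynomial `Φ` over `k` in the coordinates `Coord` (coefficients of the
`f_{m,i}` and of their inverses, finitely many) vanishing at the periods — `Φ(c) = 0` in `ℂ`,
coefficients embedded by `σ` — vanishes at every `R`-point `f` of the torsor, for every commutative
`k`-algebra `R`; that is, `I(c) ⊆ I(Ω^And_{X₀})`. In the words of Bost–Charles (after
Conj. 2.12): every polynomial relation over `k` among the periods `(2πi)^{-j} ∫_γ α` of the powers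
of `X₀` is induced by motivated cycles on these powers. POSED for `k = ℚ̄` (`AlgebraicClosure ℚ`),
`X₀` smooth projective of dimension `n` and the classical realization; known for CM elliptic
curves (Chudnovsky) and few other cases (loc. cit. §2.2.2); no `_holds` is to be expected, use it
as a hypothesis. For `k` not algebraic over `ℚ` it is asserted by no one. [cite: BostCharles2014, Conj. 2.12 with Def. 2.9 and Cor. 2.11] -/
@[conjecture] def TorsorPeriodConjecture : Prop :=
  ∀ Φ : MvPolynomial (P.Coord σ X₀) k, MvPolynomial.aeval (P.periodCoord σ X₀) Φ = 0 →
    ∀ (R : Type) [CommRing R] [Algebra k R] [Algebra ℚ R] (f : P.MotivatedPeriodTorsor σ n X₀ R),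
      MvPolynomial.aeval f.coord Φ = 0

/-- The linear case of `TorsorPeriodConjecture` (the polynomial `Φ = X_x` of a single
coordinate): a coordinate vanishing at the comparison vanishes at every point of the torsor. With
`x = .isoInv m i β ψ`, `ψ` ranging over the annihilator of `Fᵖ H_dR`, this is the form consumed by
item `TorsorGPCImpliesPolicing` (`c⁻¹(1 ⊗ β) ∈ ℂ ⊗ Fᵖ ⟹ f⁻¹(1 ⊗ β) ∈ R ⊗ Fᵖ`). [folklore] -/
lemma TorsorPeriodConjecture.coord_eq_zero (h : P.TorsorPeriodConjecture σ n X₀)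
    {x : P.Coord σ X₀} (hx : P.periodCoord σ X₀ x = 0)
    {R : Type} [CommRing R] [Algebra k R] [Algebra ℚ R] (f : P.MotivatedPeriodTorsor σ n X₀ R) :
    f.coord x = 0 := by
  have h' := h (MvPolynomial.X x) (by rw [MvPolynomial.aeval_X, hx]) R f
  rwa [MvPolynomial.aeval_X] at h'

/-! ### The comparison isomorphism is a complex point of the torsor -/

section ComparisonPoint

variable (P σ)

/-- **The comparison isomorphism is a complex point of the torsor of motivated periods**
(Bost–Charles 2014, Lemma 2.5 and Cor. 2.11, `Z_X ⊂ Ω^And_X`, "tautologically"): for `X₀` smooth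
projective of dimension `n`, the family `(P.isoEquiv σ _ i)` on the powers `X₀^m` (smooth
projective of dimension `m * n`, `IsSmoothProjective.pow`) with `tate = 2πi` is an
`AlongHom ℂ σ`-point, by the axioms `iso_pullback`, `iso_one`, `iso_cup` of `PeriodRealization`
and the definition of de Rham partners. [cite: BostCharles2014, Lemma 2.5 and Cor. 2.11] -/
def comparisonPoint (hX : IsSmoothProjective n X₀) :
    P.MotivatedPeriodTorsor σ n X₀ (AlongHom ℂ σ) where
  iso m i := P.isoEquiv σ (hX.pow m) i
  tate := (isUnit_twoPiI σ).unit
  iso_pullback m m' φ i x := P.iso_pullback σ (hX.pow m) (hX.pow m') φ i x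
  iso_one m := P.iso_one σ (hX.pow m)
  iso_cup m i j l h x y := P.iso_cup σ (hX.pow m) h x y
  iso_motivated m p α β _ hαβ := by
    rw [IsUnit.unit_spec]
    exact hαβ

/-- The isomorphisms of `comparisonPoint` are the comparison maps `P.iso`. [folklore] -/
@[simp]
lemma comparisonPoint_iso_apply (hX : IsSmoothProjective n X₀) (m i : ℕ)
    (x : AlongHom ℂ σ ⊗[k] P.dR.obj (X₀.pow m) i) :
    (P.comparisonPoint σ hX).iso m i x = P.iso σ (X₀.pow m) i x := rfl

/-- The inverse isomorphisms of `comparisonPoint` are the inverse comparison maps `P.isoInv`. [folklore] -/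
@[simp]
lemma comparisonPoint_iso_symm_apply (hX : IsSmoothProjective n X₀) (m i : ℕ)
    (y : AlongHom ℂ σ ⊗[ℚ] (P.B.comap σ).obj (X₀.pow m) i) :
    ((P.comparisonPoint σ hX).iso m i).symm y = P.isoInv σ (X₀.pow m) i y := rfl

/-- The Tate value of `comparisonPoint` is `2πi`. [folklore] -/
@[simp]
lemma comparisonPoint_tate (hX : IsSmoothProjective n X₀) :
    ((P.comparisonPoint σ hX).tate : AlongHom ℂ σ) = twoPiI σ := rfl

/-- The coordinates of `comparisonPoint` are the period coordinates `periodCoord`. [folklore] -/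
@[simp]
lemma coord_comparisonPoint (hX : IsSmoothProjective n X₀) :
    (P.comparisonPoint σ hX).coord = P.periodCoord σ X₀ := by
  funext x
  cases x <;> rfl

end ComparisonPoint

/-! ### The action of automorphisms fixing motivated classes -/

variable (P σ n X₀) in
/-- A family `g = (g_{m,i})` of `ℚ`-linear automorphisms of the Betti cohomology `Hⁱ_B((X₀^m)_σ)`
of the powers of `X₀` **is a motivated automorphism family**: natural for the `k`-morphisms
between powers, unital, multiplicative, and fixing every motivated class `β ∈ A_motᵖ((X₀^m)_σ)` —
the `ℚ`-points of the kernel `G¹_And` of the Tate character of André's motivated Galois group of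
`⟨X₀⟩`, read on the powers (André 1996, §4.6 Définition, (ii); Deligne 1982, Prop. 3.1); the
hypotheses of `act`. [cite: Andre1996Motifs, §4.6 Définition (ii)] -/
structure IsMotivatedAutFamily
    (g : ∀ m i : ℕ, (P.B.comap σ).obj (X₀.pow m) i ≃ₗ[ℚ] (P.B.comap σ).obj (X₀.pow m) i) :
    Prop where
  /-- Naturality for every `k`-morphism between powers. -/
  pullback : ∀ ⦃m m' : ℕ⦄ (φ : X₀.pow m ⟶ X₀.pow m') (i : ℕ)
    (y : (P.B.comap σ).obj (X₀.pow m') i),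
    g m i ((P.B.comap σ).pullback φ i y) = (P.B.comap σ).pullback φ i (g m' i y)
  /-- Unitality. -/
  one : ∀ m : ℕ, g m 0 ((P.B.comap σ).one (X₀.pow m)) = (P.B.comap σ).one (X₀.pow m)
  /-- Multiplicativity for cup products. -/
  cup : ∀ (m : ℕ) ⦃i j l : ℕ⦄ (h : i + j = l) (x : (P.B.comap σ).obj (X₀.pow m) i)
    (y : (P.B.comap σ).obj (X₀.pow m) j),
    g m l ((P.B.comap σ).cup h x y) = (P.B.comap σ).cup h (g m i x) (g m j y)
  /-- Every motivated class is fixed. -/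
  motivated : ∀ (m p : ℕ),
    ∀ β ∈ P.B.W.motivatedClasses (m * n) ((baseChangeHom σ).obj (X₀.pow m)) p, g m (2 * p) β = β

namespace MotivatedPeriodTorsor

/-- Base change commutes with bilinear maps intertwined by linear maps: if
`g_l (B x y) = B' (g_i x) (g_j y)` then the same holds for the `R`-bilinear extensions. Auxiliary
for `act`. [folklore] -/
lemma baseChange_baseChangeBilin {K R : Type*} [CommRing K] [CommRing R] [Algebra K R]
    {M N Q M' N' Q' : Type*}
    [AddCommGroup M] [Module K M] [AddCommGroup N] [Module K N] [AddCommGroup Q] [Module K Q]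
    [AddCommGroup M'] [Module K M'] [AddCommGroup N'] [Module K N'] [AddCommGroup Q'] [Module K Q']
    (B : M →ₗ[K] N →ₗ[K] Q) (B' : M' →ₗ[K] N' →ₗ[K] Q') (gM : M →ₗ[K] M') (gN : N →ₗ[K] N')
    (gQ : Q →ₗ[K] Q') (hg : ∀ x y, gQ (B x y) = B' (gM x) (gN y)) (x : R ⊗[K] M) (y : R ⊗[K] N) :
    gQ.baseChange R (baseChangeBilin R B x y) =
      baseChangeBilin R B' (gM.baseChange R x) (gN.baseChange R y) := by
  induction x using TensorProduct.induction_on with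
  | zero => simp
  | add x x' hx hx' => simp [hx, hx']
  | tmul a v =>
    induction y using TensorProduct.induction_on with
    | zero => simp
    | add y y' hy hy' => simp [hy, hy']
    | tmul b w => simp [hg]

variable {R : Type} [CommRing R] [Algebra k R] [Algebra ℚ R]
  {g : ∀ m i : ℕ, (P.B.comap σ).obj (X₀.pow m) i ≃ₗ[ℚ] (P.B.comap σ).obj (X₀.pow m) i}

/-- **The torsor is stable under automorphisms fixing the motivated classes** (Bost–Charles 2014,
§2.1.2: `Ω^T_M` is a torsor under the Tannakian group; here the `ℚ`-points of the kernel of the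
Tate character, `IsMotivatedAutFamily`): `f ↦ g ∘ f` (with the same Tate value) maps `R`-points
of the torsor to `R`-points. This is the step "`g · c ∈ Ω^And(ℂ)`" of the consumer item
`TorsorGPCImpliesPolicing` (route `HodgeConjecture/PeriodsPolice`). [cite: BostCharles2014, §2.1.2] -/
def act (hg : P.IsMotivatedAutFamily σ n X₀ g) (f : P.MotivatedPeriodTorsor σ n X₀ R) :
    P.MotivatedPeriodTorsor σ n X₀ R where
  iso m i := (f.iso m i).trans ((g m i).baseChange ℚ R _ _)
  tate := f.tate
  iso_pullback m m' φ i x := by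
    simp only [LinearEquiv.trans_apply]
    rw [f.iso_pullback]
    generalize f.iso m' i x = y
    induction y using TensorProduct.induction_on with
    | zero => rw [map_zero, map_zero, map_zero, map_zero]
    | add y y' hy hy' => rw [map_add, map_add, hy, hy', map_add, map_add]
    | tmul b w =>
      rw [LinearMap.baseChange_tmul, LinearEquiv.baseChange_tmul, LinearEquiv.baseChange_tmul,
        LinearMap.baseChange_tmul, hg.pullback]
  iso_one m := by
    simp only [LinearEquiv.trans_apply, f.iso_one, LinearEquiv.baseChange_tmul, hg.one]
  iso_cup m i j l h x y := by
    simp only [LinearEquiv.trans_apply, f.iso_cup]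
    exact baseChange_baseChangeBilin _ _ _ _ _ (hg.cup m h) _ _
  iso_motivated m p α β hβ hαβ := by
    simp only [LinearEquiv.trans_apply, f.iso_motivated m p α β hβ hαβ, map_smul,
      LinearEquiv.baseChange_tmul, hg.motivated m p β hβ]

/-- The isomorphisms of `f.act hg` are `g_R ∘ f`. [folklore] -/
@[simp]
lemma act_iso_apply (hg : P.IsMotivatedAutFamily σ n X₀ g) (f : P.MotivatedPeriodTorsor σ n X₀ R)
    (m i : ℕ) (x : R ⊗[k] P.dR.obj (X₀.pow m) i) :
    (f.act hg).iso m i x = (g m i).baseChange ℚ R _ _ (f.iso m i x) := rfl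

/-- The inverse isomorphisms of `f.act hg` are `f⁻¹ ∘ g_R⁻¹`. [folklore] -/
@[simp]
lemma act_iso_symm_apply (hg : P.IsMotivatedAutFamily σ n X₀ g)
    (f : P.MotivatedPeriodTorsor σ n X₀ R) (m i : ℕ)
    (y : R ⊗[ℚ] (P.B.comap σ).obj (X₀.pow m) i) :
    ((f.act hg).iso m i).symm y = (f.iso m i).symm (((g m i).baseChange ℚ R _ _).symm y) := rfl

/-- The Tate value is unchanged by `act` (the acting group is the kernel of the Tate
character). [folklore] -/
@[simp]
lemma act_tate (hg : P.IsMotivatedAutFamily σ n X₀ g) (f : P.MotivatedPeriodTorsor σ n X₀ R) :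
    (f.act hg).tate = f.tate := rfl

end MotivatedPeriodTorsor

end PeriodRealization

end Literature.AlgebraicGeometry.Motives

end
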